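import Summits.BirchSwinnertonDyer.BirchSwinnertonDyer.Theorems.ManinLocalTwoThreeAlgIntCubeRoot
import HarnessLib

/-!
# (INT)_K, step A: the renormalised cube root has coefficients in `ℤ̄[1/3]`
(route `ManinLocalTwoThree`, crux C3 `ManinPrimeToThreeAtNine` stmt-BirchSwinnertonDyer-22968; cell bsd-f2-manin, prover seat p3 gen 16 —
piece (INT)_K of -an g39's `K`-rational UDC line, p2 g18's interface; `--supports` 22968)

If `g ∈ ℂ⟦q⟧` has `g(0) = −1` and `g³ = −P − y·z_W³ − λ·(P·z_W − x·z_W³)` with `P, z_W ∈ ℤ⟦q⟧` (given as rational series with integer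
coefficients), `3x ∈ ℤ`, and `9y`, `λ` algebraic integers, then every coefficient `gₙ` has `3ᵏgₙ ∈ ℤ̄` for some `k = k(n)`:
the right-hand side has coefficients in the subring `S = {w | ∃ k, 3ᵏw ∈ ℤ̄} ∋ 1/3` (`…AlgIntCubeRoot.exists_subring_iff_isIntegral_pow_mul`) and
cube roots with constant term `−1` stay in `S` (`…AlgIntCubeRoot.coeff_mem_of_pow_three_eq`).

* `exists_isIntegral_pow_mul_coeff_of_cube` — the statement above.

HONEST FRAMING.  Pure algebra; nothing about (INT)_K's conclusion, C3, Manin's conjecture or BSD is proved here.  No definitions, no sorry.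
[folklore]
-/

set_option autoImplicit false
-- lint-debt: the directory name repeats the summit name (sibling precedent `ManinLocalTwoThreeAlgIntCubeRoot.lean`)
set_option linter.dupNamespace false

noncomputable section

open scoped Classical
open PowerSeries

namespace Summit.BirchSwinnertonDyer.BirchSwinnertonDyer.Theorems.ManinLocalTwoThree.AlgIntCubeRoot

/-- A rational series with integer coefficients, mapped to `ℂ`, is the image of an `S`-series for any subring `S ⊆ ℂ`. [folklore] -/
theorem exists_map_subtype_eq_map_of_int (S : Subring ℂ) {P : ℚ⟦X⟧} (hP : ∀ n, ∃ k : ℤ, coeff n P = k) :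
    ∃ P' : S⟦X⟧, PowerSeries.map S.subtype P' = PowerSeries.map (algebraMap ℚ ℂ) P := by
  choose k hk using hP
  refine ⟨PowerSeries.mk fun n ↦ ((k n : ℤ) : S), ?_⟩
  ext n
  rw [coeff_map, coeff_mk, coeff_map, hk n, eq_ratCast]
  simp

/-- **Step A of (INT)_K.**  `g(0) = −1`, `g³ = −P − y·z_W³ − λ·(P·z_W − x·z_W³)` with `P, z_W` integer series, `3x ∈ ℤ`, `9y, λ ∈ ℤ̄`
⟹ `∀ n, ∃ k, 3ᵏ·gₙ ∈ ℤ̄`. [folklore] -/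
theorem exists_isIntegral_pow_mul_coeff_of_cube {P zW : ℚ⟦X⟧} (hP : ∀ n, ∃ k : ℤ, coeff n P = k) (hzW : ∀ n, ∃ k : ℤ, coeff n zW = k)
    {x : ℚ} (hx : ∃ m : ℤ, (m : ℚ) = 3 * x) {y lam : ℂ} (hy : IsIntegral ℤ (9 * y)) (hl : IsIntegral ℤ lam)
    {g : ℂ⟦X⟧} (hg0 : constantCoeff g = -1)
    (hg3 : g ^ 3 = -PowerSeries.map (algebraMap ℚ ℂ) P - C y * PowerSeries.map (algebraMap ℚ ℂ) zW ^ 3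
      - C lam * (PowerSeries.map (algebraMap ℚ ℂ) P * PowerSeries.map (algebraMap ℚ ℂ) zW
          - C ((x : ℚ) : ℂ) * PowerSeries.map (algebraMap ℚ ℂ) zW ^ 3)) :
    ∀ n, ∃ k : ℕ, IsIntegral ℤ ((3 : ℂ) ^ k * coeff n g) := by
  obtain ⟨S, hS⟩ := exists_subring_iff_isIntegral_pow_mul ℂ
  -- the scalars lie in `S`
  have hyS : y ∈ S := (hS y).mpr ⟨2, by norm_num; exact hy⟩
  have hlS : lam ∈ S := (hS lam).mpr ⟨0, by simpa using hl⟩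
  have hxS : ((x : ℚ) : ℂ) ∈ S := by
    obtain ⟨m, hm⟩ := hx
    refine (hS _).mpr ⟨1, ?_⟩
    rw [pow_one, show (3 : ℂ) * ((x : ℚ) : ℂ) = ((3 * x : ℚ) : ℂ) by push_cast; ring, ← hm, Rat.cast_intCast]
    exact isIntegral_algebraMap
  have h13S : (1 / 3 : ℂ) ∈ S := (hS _).mpr ⟨1, by norm_num; exact isIntegral_one⟩
  -- the right-hand side is an `S`-series
  obtain ⟨P', hP'⟩ := exists_map_subtype_eq_map_of_int S hP
  obtain ⟨zW', hzW'⟩ := exists_map_subtype_eq_map_of_int S hzW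
  set Θ' : S⟦X⟧ := -P' - C (⟨y, hyS⟩ : S) * zW' ^ 3 - C (⟨lam, hlS⟩ : S) * (P' * zW' - C (⟨((x : ℚ) : ℂ), hxS⟩ : S) * zW' ^ 3)
    with hΘ'
  have hΘmap : PowerSeries.map S.subtype Θ' = g ^ 3 := by
    rw [hg3, hΘ']
    simp only [map_sub, map_neg, map_mul, map_pow, PowerSeries.map_C, hP', hzW']
    rfl
  have hΘS : ∀ n, coeff n (g ^ 3) ∈ S := fun n ↦ by
    rw [← hΘmap, coeff_map]; exact (coeff n Θ').2
  intro n
  exact (hS _).mp (coeff_mem_of_pow_three_eq S h13S (by norm_num) hΘS rfl hg0 n)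

end Summit.BirchSwinnertonDyer.BirchSwinnertonDyer.Theorems.ManinLocalTwoThree.AlgIntCubeRoot

end
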